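import Mathlib
import Summits.CriticalPhenomena.Ising3DConformalLimit.Theses.GaussianScaleMixture
import Summits.CriticalPhenomena.Ising3DConformalLimit.Theorems.GSMRigidity.Negative.ThreeAtomKernel
import Literature.MathematicalPhysics.QuantumFieldTheory.LatticeMirrorNormals
import Literature.MathematicalPhysics.QuantumFieldTheory.MirrorRPKernel

/-!
# `GSMRigidity` (item stmt-CriticalPhenomena-8366): sums of inverse quadrics are Gaussian scale mixtures; the planner's falsifier family is not swap-RP — exact certificates at `ε = 1/2` and `ε = 1/5`

Negative knowledge about the crux
`Summit.CriticalPhenomena.Ising3DConformalLimit.Theses.GaussianScaleMixture.GSMRigidity`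
(standing crux disprover, cycle 2, D-0016), split off the work file
`Summits/CriticalPhenomena/Ising3DConformalLimit/Cruxes/GSMRigidity/Disproof.lean` (findings F10).

* `quadricSum_isGSM`: EVERY finite positive sum `Σ_t 1/(w_t · x²)` of inverse diagonal quadrics
  (`w_t` in the open octant) is a Gaussian scale mixture in the sense of the crux — an honest measure
  on `Fin 3 → ℝ` carried by `N` rays of the closed octant, with the integrability and the integral
  identity proved (`1/L = ∫₀^∞ e^{-rL} dr`). This generalises `threeAtomKernel_isGSM`.
* `plannerKernel ε = Σ_{σ ∈ S₃} 1/(ω_σ · x²)`, `ω = (1+ε, 1-ε, 1)`: the route's CHEAPEST-FALSIFIER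
  family (route file GaussianScaleMixture, "Cheapest falsifier", there at `Δ = 0.518`; here at
  `Δ = 1`, where all values are rational), a `B₃`-symmetric Gaussian scale mixture, positive off the
  origin, round iff `ε = 0`.
* `plannerKernel_half_not_swapRP`: at `ε = 1/2` it is NOT reflection positive for the swap mirror
  `x₁ = x₂` — a THREE-point certificate `(2,-2,0), (3,-1,0), (4,0,0)`, coefficients `(1,-2,1)` (the RP
  form is the fourth central difference of `d ↦ k(4+d, d-4, 0)`), value
  `-2764183781/1735113259880 < 0`.
* `plannerKernel_fifth_not_swapRP`: at `ε = 1/5`, a SEVEN-point certificate `(6+a, a-6, 0)`,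
  `a = 0..6`, coefficients the binomial sixth difference `(1,-6,15,-20,15,-6,1)`, value
  `≈ -1.7·10⁻⁸ < 0` (exact rational). Exactly (rational arithmetic, work file F10) the minimal order
  of such a finite-difference certificate is `n = 2,3,3,4,5,6,7,8,10,12` for
  `ε = 1/2, 2/5, 1/3, 3/10, 1/4, 1/5, 1/6, 1/7, 1/8, 1/10` (`n ≈ 1.2/ε`, relative size `~ e^{-c/ε}`):
  no anisotropy is small enough to be swap-RP, in line with the circle-lemma proof of the crux
  recorded in the work file; so the planner's kill criterion for r3 cannot fire.

Definitions: only explicit witness data (`quadricSum`, `rayOf`, `quadricSumMeasure`,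
`plannerWeights`, `plannerKernel`); no `Prop` definitions.
-/

noncomputable section

open scoped BigOperators InnerProductSpace
open MeasureTheory Set Literature.MathematicalPhysics.QuantumFieldTheory

namespace Summit.CriticalPhenomena.Ising3DConformalLimit.Theorems.GSMRigidity.Negative

/-! ## Finite sums of inverse quadrics are Gaussian scale mixtures -/

/-- A positive diagonal quadratic form is positive off the origin. [folklore] -/
theorem quadForm_pos {w : Fin 3 → ℝ} (hw : ∀ j, 0 < w j) {x : E3} (hx : x ≠ 0) :
    0 < ∑ j, w j * x j ^ 2 := by
  obtain ⟨i, hi⟩ := exists_coord_ne_zero hx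
  exact Finset.sum_pos' (fun j _ => mul_nonneg (hw j).le (sq_nonneg _))
    ⟨i, Finset.mem_univ _, mul_pos (hw i) (by positivity)⟩

/-- `Σ_t 1/(w_t · x²)`: a finite sum of inverse diagonal quadrics. [folklore] -/
def quadricSum {N : ℕ} (w : Fin N → Fin 3 → ℝ) (x : E3) : ℝ := ∑ t, 1 / (∑ j, w t j * x j ^ 2)

/-- The ray `r ↦ r • w` in the closed octant. [folklore] -/
def rayOf (w : Fin 3 → ℝ) (r : ℝ) : Fin 3 → ℝ := fun j => r * w j

/-- The ray map is measurable. [folklore] -/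
theorem measurable_rayOf (w : Fin 3 → ℝ) : Measurable (rayOf w) :=
  measurable_pi_lambda _ fun _ => measurable_id.mul_const _

/-- `ν_w = Σ_t (rayOf w_t)_* (Lebesgue on (0,∞))`. [folklore] -/
def quadricSumMeasure {N : ℕ} (w : Fin N → Fin 3 → ℝ) : Measure (Fin 3 → ℝ) :=
  ∑ t, Measure.map (rayOf (w t)) (volume.restrict (Ioi (0:ℝ)))

/-- `ν_w` lives on the closed octant. [folklore] -/
theorem quadricSumMeasure_negSet {N : ℕ} (w : Fin N → Fin 3 → ℝ) (hw : ∀ t j, 0 < w t j) :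
    quadricSumMeasure w {s | ∃ i, s i < 0} = 0 := by
  rw [quadricSumMeasure, Measure.finsetSum_apply]
  refine Finset.sum_eq_zero fun t _ => ?_
  rw [Measure.map_apply (measurable_rayOf _) measurableSet_negSet,
    Measure.restrict_apply' measurableSet_Ioi]
  have : rayOf (w t) ⁻¹' {s : Fin 3 → ℝ | ∃ i, s i < 0} ∩ Ioi 0 = ∅ := by
    ext r
    simp only [Set.mem_inter_iff, Set.mem_preimage, Set.mem_setOf_eq, Set.mem_Ioi,
      Set.mem_empty_iff_false, iff_false, not_and, forall_exists_index]
    intro j hj hr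
    have : 0 < rayOf (w t) r j := mul_pos hr (hw t j)
    linarith
  rw [this, measure_empty]

/-- The Gaussian exponent along a ray. [folklore] -/
theorem sum_rayOf_mul_sq (w : Fin 3 → ℝ) (x : E3) (r : ℝ) :
    ∑ j, rayOf w r j * x j ^ 2 = (∑ j, w j * x j ^ 2) * r := by
  rw [Finset.sum_mul]
  exact Finset.sum_congr rfl fun j _ => by simp only [rayOf]; ring

/-- **Every finite positive sum of inverse diagonal quadrics is a Gaussian scale mixture in the
sense of the crux**: `ν` on the closed octant, integrand integrable and
`Σ_t 1/(w_t·x²) = ∫ exp(-Σ sᵢ xᵢ²) dν(s)` at every `x ≠ 0`. [folklore] -/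
theorem quadricSum_isGSM {N : ℕ} (w : Fin N → Fin 3 → ℝ) (hw : ∀ t j, 0 < w t j) :
    ∃ ν : MeasureTheory.Measure (Fin 3 → ℝ), ν {s | ∃ i, s i < 0} = 0 ∧
      ∀ x : E3, x ≠ 0 → MeasureTheory.Integrable (fun s => Real.exp (-∑ i, s i * (x i) ^ 2)) ν ∧
        quadricSum w x = ∫ s, Real.exp (-∑ i, s i * (x i) ^ 2) ∂ν := by
  refine ⟨quadricSumMeasure w, quadricSumMeasure_negSet w hw, fun x hx => ?_⟩
  set g : (Fin 3 → ℝ) → ℝ := fun s => Real.exp (-∑ i, s i * (x i) ^ 2) with hg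
  have hgc : Continuous g := continuous_gaussIntegrand x
  have hcomp : ∀ t, g ∘ rayOf (w t) = fun r => Real.exp (-(∑ j, w t j * x j ^ 2) * r) := by
    intro t; funext r
    simp only [Function.comp_apply, hg, sum_rayOf_mul_sq, neg_mul]
  have hint : ∀ t, Integrable g (Measure.map (rayOf (w t)) (volume.restrict (Ioi (0:ℝ)))) := by
    intro t
    rw [integrable_map_measure hgc.aestronglyMeasurable (measurable_rayOf _).aemeasurable, hcomp t]
    exact exp_neg_integrableOn_Ioi 0 (quadForm_pos (hw t) hx)
  refine ⟨integrable_finsetSum_measure.2 fun t _ => hint t, ?_⟩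
  rw [quadricSumMeasure, integral_finsetSum_measure fun t _ => hint t]
  unfold quadricSum
  refine Finset.sum_congr rfl fun t _ => ?_
  rw [integral_map (measurable_rayOf _).aemeasurable hgc.aestronglyMeasurable,
    ← integral_exp_neg_mul_Ioi (quadForm_pos (hw t) hx)]
  refine integral_congr_ae (Filter.Eventually.of_forall fun r => ?_)
  have h := congrFun (hcomp t) r
  simp only [Function.comp_apply] at h
  simp only [h, neg_mul]

/-- A nonempty positive sum of inverse quadrics is positive off the origin. [folklore] -/
theorem quadricSum_pos {N : ℕ} [NeZero N] (w : Fin N → Fin 3 → ℝ) (hw : ∀ t j, 0 < w t j)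
    {x : E3} (hx : x ≠ 0) : 0 < quadricSum w x :=
  Finset.sum_pos (fun t _ => one_div_pos.2 (quadForm_pos (hw t) hx)) Finset.univ_nonempty

/-! ## The planner's cheapest-falsifier family at `Δ = 1` -/

/-- Weights of the planner's falsifier family: the six permutations of `(1+ε, 1-ε, 1)` (the
simplex normalisation `/3` only rescales the kernel by a positive constant). [folklore] -/
def plannerWeights (ε : ℝ) : Fin 6 → Fin 3 → ℝ :=
  ![![1 + ε, 1 - ε, 1], ![1 - ε, 1 + ε, 1], ![1 + ε, 1, 1 - ε], ![1 - ε, 1, 1 + ε],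
    ![1, 1 + ε, 1 - ε], ![1, 1 - ε, 1 + ε]]

/-- The weights are positive for `|ε| < 1`. [folklore] -/
theorem plannerWeights_pos {ε : ℝ} (hε : |ε| < 1) (t : Fin 6) (j : Fin 3) :
    0 < plannerWeights ε t j := by
  have h1 : 0 < 1 + ε := by linarith [(abs_lt.1 hε).1]
  have h2 : 0 < 1 - ε := by linarith [(abs_lt.1 hε).2]
  fin_cases t <;> fin_cases j <;> simp [plannerWeights, h1, h2]

/-- The planner's falsifier family `k_ε(x) = Σ_{σ ∈ S₃} 1/(ω_σ · x²)`, `ω = (1+ε, 1-ε, 1)`, at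
`Δ = 1`. [folklore] -/
def plannerKernel (ε : ℝ) (x : E3) : ℝ := quadricSum (plannerWeights ε) x

/-- The family consists of Gaussian scale mixtures in the sense of the crux. [folklore] -/
theorem plannerKernel_isGSM {ε : ℝ} (hε : |ε| < 1) :
    ∃ ν : MeasureTheory.Measure (Fin 3 → ℝ), ν {s | ∃ i, s i < 0} = 0 ∧
      ∀ x : E3, x ≠ 0 → MeasureTheory.Integrable (fun s => Real.exp (-∑ i, s i * (x i) ^ 2)) ν ∧
        plannerKernel ε x = ∫ s, Real.exp (-∑ i, s i * (x i) ^ 2) ∂ν :=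
  quadricSum_isGSM _ (plannerWeights_pos hε)

/-- The family is positive off the origin. [folklore] -/
theorem plannerKernel_pos {ε : ℝ} (hε : |ε| < 1) {x : E3} (hx : x ≠ 0) : 0 < plannerKernel ε x :=
  quadricSum_pos _ (plannerWeights_pos hε) hx

/-- Values in the plane `x₃ = 0`. [folklore] -/
theorem plannerKernel_mk (ε u v : ℝ) : plannerKernel ε (mk u v) =
    1 / ((1 + ε) * u ^ 2 + (1 - ε) * v ^ 2) + 1 / ((1 - ε) * u ^ 2 + (1 + ε) * v ^ 2) +
    1 / ((1 + ε) * u ^ 2 + v ^ 2) + 1 / ((1 - ε) * u ^ 2 + v ^ 2) +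
    1 / (u ^ 2 + (1 + ε) * v ^ 2) + 1 / (u ^ 2 + (1 - ε) * v ^ 2) := by
  simp [plannerKernel, quadricSum, plannerWeights, Fin.sum_univ_succ, mk_apply_zero, mk_apply_one,
    mk_apply_two]
  ring

/-- **The planner's falsifier family is not swap-RP at `ε = 1/2`: a THREE-point certificate.**
Points `(2,-2,0), (3,-1,0), (4,0,0)` (open half-space `x₁ - x₂ > 0`), coefficients `(1,-2,1)`; the
RP form is the fourth central difference of `d ↦ k(4+d, d-4, 0)` and equals
`-2764183781/1735113259880 < 0`. [folklore] -/
theorem plannerKernel_half_not_swapRP : ¬ IsMirrorRPKernel nSwap (plannerKernel (1 / 2)) := by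
  intro h
  have key := h 3 ![mk 2 (-2), mk 3 (-1), mk 4 0] ![1, -2, 1] (by
    intro a
    fin_cases a <;> norm_num [inner_mk_nSwap])
  simp only [Fin.sum_univ_three, Matrix.cons_val_zero, Matrix.cons_val_one, Matrix.cons_val,
    reflection_nSwap_mk, mk_sub_mk, plannerKernel_mk] at key
  norm_num at key

/-- **The planner's falsifier family is not swap-RP at `ε = 1/5`: a SEVEN-point certificate.**
Points `(6+a, a-6, 0)`, `a = 0,…,6`, coefficients the binomial sixth difference
`(1,-6,15,-20,15,-6,1)`; the RP form is the twelfth central difference of `d ↦ k(12+d, d-12, 0)`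
and is `≈ -1.7·10⁻⁸ < 0` (an exact 50-over-58-digit rational). [folklore] -/
theorem plannerKernel_fifth_not_swapRP : ¬ IsMirrorRPKernel nSwap (plannerKernel (1 / 5)) := by
  intro h
  have key := h 7 ![mk 6 (-6), mk 7 (-5), mk 8 (-4), mk 9 (-3), mk 10 (-2), mk 11 (-1), mk 12 0]
    ![1, -6, 15, -20, 15, -6, 1] (by
    intro a
    fin_cases a <;> norm_num [inner_mk_nSwap])
  simp only [Fin.sum_univ_seven, Matrix.cons_val_zero, Matrix.cons_val_one, Matrix.cons_val,
    reflection_nSwap_mk, mk_sub_mk, plannerKernel_mk] at key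
  norm_num at key

end Summit.CriticalPhenomena.Ising3DConformalLimit.Theorems.GSMRigidity.Negative
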